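import Summits.ABC.StewartYu.KappaDoorEven
import Summits.ABC.StewartYu.KappaDoorOdd
import Summits.ABC.StewartYu.PrimePadicSocketTools
import HarnessLib

/-!
# Cell abc-stewartyu, the κ-DOOR, IV: the `ε`-endgame — `log c ≪_ε rad(abc)^{max(1,κ)+ε}` from a
# `p`-adic bound of shape `K·Lⁿ·n^{κn}·p^σ·…` (`σ ≤ 2`) at the ODD primes alone

`Summits/ABC/StewartYu/KappaDoor.lean` — cell `abc-stewartyu` (HOME
`run/shared/lean/pub/abc-stewartyu/`, seat p3; the planner's `stub_oddKappaDoor` / `OddKappaDoorSpec`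
of HOME/plan/Skeleton.lean v2a and HOME/plan/KAPPA-DOOR-RECIPE.md; theorems only).

* `finBoundAt_mono_kappa` — the input with exponent `κ` implies the input with any `κ' ≥ κ`
  (`n^{κn} ≤ n^{κ'n}`), so one may assume `κ' = max(1, κ) ≥ 1`;
* `le_rpow_of_sq_le` — `u ≥ 1`, `u² ≤ C·X·u^δ` (`0 < δ < 2`) ⟹ `u ≤ (C X)^{1/(2−δ)}`;
* `log_sq_le_of_finBound` — the two-slot inequality (`KappaDoorEven` ∪ `KappaDoorOdd`);
* **`epsShape_of_oddFinBound`** — for `K ≥ 0`, `L ≥ 1`, any real `κ`, `0 ≤ σ ≤ 2` and the input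
  `FinBoundAt p K L κ σ τ τ₁` at every odd prime `p`: for every `ε > 0` there are `κ₀, c₀` with
  `log c ≤ κ₀ · rad(abc)^{max(1,κ)+ε}` for all abc triples with `c ≥ c₀` (in fact `c₀ = 3`) — i.e.
  the planner's `OddKappaDoorSpec ⟹ EpsShapeBound (max 1 κ)` (the statement is that `Prop` unfolded).
  Proof: `KappaDoorMain.log_sq_le_of_finBound` ((17)–(18) of the printed line with two slots), then
  `D^r ≤ A(ε) G^ε` (`exists_pow_le_mul_rpow`, Lemma 4 once more), `(log G)^N ≤ c G^ε`
  (`log_pow_le_mul_rpow`), and the resolution of `u² ≤ C G^{2κ'+ε/2} (log 6u)^N`.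

Everything is [folklore] book-keeping; compare the tree's `stewartYu1991_of_yu1990_waldschmidt1980`
(κ = 1, σ = 2, three slots, exponent 2/3) [cite: StewartYu1991, Theorem (p. 226)].
-/

noncomputable section

open Finset Real
open Literature.NumberTheory.DiophantineGeometry
open Literature.Barriers.ABC

namespace Summit.ABC.StewartYu

namespace KappaDoor

/-- **The square of `log c` from two slots** (both parities): for an abc triple `a + b = c` with
`a ≤ b`, `c ≥ 3`, and the input `FinBoundAt p K L κ' σ τ τ₁` at every odd prime (`κ' ≥ 1`, `0 ≤ σ ≤ 2`):
`(log c)² ≤ 512·max(1,K)²·(600 M₀)^{2r}·600²·G²·(W²)^{κ'−1}·(log G)^{2τ₁+9}·(log(6 log c))^{2τ+1}`.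
[folklore] -/
theorem log_sq_le_of_finBound {K L κ' σ : ℝ} {τ τ₁ : ℕ} (hK : 0 ≤ K) (hL : 1 ≤ L) (hκ' : 1 ≤ κ')
    (hσ0 : 0 ≤ σ) (hσ : σ ≤ 2) (hP : ∀ p : ℕ, p.Prime → p ≠ 2 → FinBoundAt p K L κ' σ τ τ₁)
    {a b c : ℕ} (h : IsABCTriple a b c) (hab : a ≤ b) (hc3 : 3 ≤ c) :
    Real.log c ^ 2 ≤ 512 * max 1 K ^ 2 * (600 * max L (2 ^ 71)) ^ (2 * (a * b * c).primeFactors.card) *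
      600 ^ 2 * (rad a b c : ℝ) ^ 2 *
      (((600 : ℝ) ^ ((a * b * c).primeFactors.card + 1) * (rad a b c : ℝ)) ^ 2) ^ (κ' - 1) *
      Real.log (rad a b c : ℝ) ^ (2 * τ₁ + 9) * Real.log (6 * Real.log c) ^ (2 * τ + 1) := by
  rcases Nat.even_or_odd c with hc | hc
  · exact log_sq_le_of_finBound_even hK hL hκ' hσ0 hσ hP h hab hc3 hc
  · exact log_sq_le_of_finBound_odd hK hL hκ' hσ0 hσ hP h hab hc3 hc

/-- **Monotonicity of the input in `κ`.** [folklore] -/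
theorem finBoundAt_mono_kappa {p : ℕ} {K L κ κ' σ : ℝ} {τ τ₁ : ℕ} (hK : 0 ≤ K) (hL : 0 ≤ L)
    (hκκ' : κ ≤ κ') (hP : FinBoundAt p K L κ σ τ τ₁) : FinBoundAt p K L κ' σ τ τ₁ := by
  intro n q e hq hinj hqp he hne
  refine (hP n q e hq hinj hqp he hne).trans ?_
  have hn : (n : ℝ) ^ (κ * n) ≤ (n : ℝ) ^ (κ' * n) := by
    rcases Nat.eq_zero_or_pos n with h0 | hpos
    · subst h0; simp
    · exact Real.rpow_le_rpow_of_exponent_le (by exact_mod_cast hpos)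
        (mul_le_mul_of_nonneg_right hκκ' (Nat.cast_nonneg _))
  have hlog : 0 ≤ ∏ i, Real.log ((q i : ℕ) : ℝ) :=
    Finset.prod_nonneg fun i _ => Real.log_nonneg (by exact_mod_cast (hq i).one_lt.le)
  have h1 : 0 ≤ Real.log (max 3 ((Finset.univ.sup fun i => (e i).natAbs : ℕ) : ℝ)) ^ τ :=
    pow_nonneg (Real.log_nonneg ((le_max_left _ _).trans' (by norm_num))) _
  have h2 : 0 ≤ Real.log (max 3 (∏ i, ((q i : ℕ) : ℝ))) ^ τ₁ :=
    pow_nonneg (Real.log_nonneg ((le_max_left _ _).trans' (by norm_num))) _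
  have hp0 : 0 ≤ (p : ℝ) ^ σ := Real.rpow_nonneg (Nat.cast_nonneg _) _
  have h0 : 0 ≤ K * L ^ n := by positivity
  exact mul_le_mul_of_nonneg_right (mul_le_mul_of_nonneg_right (mul_le_mul_of_nonneg_right
    (mul_le_mul_of_nonneg_right (mul_le_mul_of_nonneg_left hn h0) hp0) hlog) h1) h2

/-- **Resolution of `u² ≤ C·X·u^δ`**: for `u ≥ 1`, `δ < 2`:
`u ≤ (C·X)^{1/(2−δ)}`. [folklore] -/
theorem le_rpow_of_sq_le {u C X δ : ℝ} (hu : 1 ≤ u) (hδ2 : δ < 2)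
    (h : u ^ 2 ≤ C * X * u ^ δ) : u ≤ (C * X) ^ (1 / (2 - δ)) := by
  have hu0 : 0 < u := by linarith
  have hd : 0 < 2 - δ := by linarith
  have h1 : u ^ (2 - δ) ≤ C * X := by
    rw [Real.rpow_sub hu0, show (2 : ℝ) = ((2 : ℕ) : ℝ) by norm_num, Real.rpow_natCast,
      div_le_iff₀ (Real.rpow_pos_of_pos hu0 δ)]
    exact h
  have h2 : u = (u ^ (2 - δ)) ^ (1 / (2 - δ)) := by
    rw [one_div, Real.rpow_rpow_inv hu0.le hd.ne']
  rw [h2]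
  exact Real.rpow_le_rpow (Real.rpow_nonneg hu0.le _) h1 (by positivity)

set_option maxHeartbeats 800000 in
/-- **The κ-door at the odd places** (planner's `OddKappaDoorSpec ⟹ EpsShapeBound (max 1 κ)`):
a `p`-adic bound `ord_p(∏qᵢ^{eᵢ} − 1) ≤ K·Lⁿ·n^{κn}·p^σ·(∏log qᵢ)·(log max(3,max|eᵢ|))^τ·(log max(3,∏qᵢ))^{τ₁}`
at every ODD prime `p` with `0 ≤ σ ≤ 2` gives, for every `ε > 0`, `log c ≤ κ₀(ε)·rad(abc)^{max(1,κ)+ε}`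
for all abc triples with `c ≥ 3`. [folklore] -/
theorem epsShape_of_oddFinBound {K L κ σ : ℝ} {τ τ₁ : ℕ} (hK : 0 ≤ K) (hL : 1 ≤ L)
    (hσ0 : 0 ≤ σ) (hσ : σ ≤ 2) (hP : ∀ p : ℕ, p.Prime → p ≠ 2 → FinBoundAt p K L κ σ τ τ₁) :
    ∀ ε : ℝ, 0 < ε → ∃ κ₀ c₀ : ℝ, ∀ a b c : ℕ, IsABCTriple a b c → c₀ ≤ (c : ℝ) →
      Real.log c ≤ κ₀ * (rad a b c : ℝ) ^ (max 1 κ + ε) := by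
  intro ε hε
  set κ' : ℝ := max 1 κ with hκ'
  have hκ'1 : 1 ≤ κ' := le_max_left _ _
  have hP' : ∀ p : ℕ, p.Prime → p ≠ 2 → FinBoundAt p K L κ' σ τ τ₁ := fun p hp hp2 =>
    finBoundAt_mono_kappa hK (by linarith) (le_max_right _ _) (hP p hp hp2)
  -- constants
  set ε₁ : ℝ := ε / 4 with hε₁
  have hε₁0 : 0 < ε₁ := by rw [hε₁]; positivity
  set M₀ : ℝ := max L (2 ^ 71) with hM₀
  have hM₀1 : 1 ≤ M₀ := hL.trans (le_max_left _ _)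
  set E : ℝ := (600 : ℝ) ^ (2 * (κ' - 1)) with hE
  have hE1 : 1 ≤ E := Real.one_le_rpow (by norm_num) (by linarith)
  have hE0 : 0 < E := by linarith
  set D : ℝ := (600 * M₀) ^ 2 * E with hD
  have hD1 : 1 ≤ D := one_le_mul_of_one_le_of_one_le (one_le_pow₀ (by linarith)) hE1
  obtain ⟨AD, hAD1, hAD⟩ := exists_pow_le_mul_rpow hD1 (by norm_num : (1 : ℝ) ≤ 600) hε₁0
  set N₁ : ℕ := 2 * τ₁ + 9 with hN₁
  set N₂ : ℕ := 2 * τ + 1 with hN₂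
  set δ : ℝ := ε / (κ' + ε) with hδ
  have hδ0 : 0 < δ := by rw [hδ]; positivity
  have hδ1 : δ < 1 := by rw [hδ, div_lt_one (by positivity)]; linarith
  set C₁ : ℝ := 512 * max 1 K ^ 2 * 600 ^ 2 * E * AD * (((N₁ : ℝ) + 1) / ε₁) ^ N₁ with hC₁
  have hC₁0 : 0 < C₁ := by rw [hC₁]; positivity
  set C₂ : ℝ := C₁ * ((((N₂ : ℝ) + 1) / δ) ^ N₂ * (6 : ℝ) ^ δ) with hC₂
  have hC₂0 : 0 < C₂ := by rw [hC₂]; positivity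
  refine ⟨C₂ ^ (1 / (2 - δ)), 3, ?_⟩
  -- WLOG `a ≤ b`
  suffices hmain : ∀ a b c : ℕ, IsABCTriple a b c → a ≤ b → (3 : ℝ) ≤ c →
      Real.log c ≤ C₂ ^ (1 / (2 - δ)) * (rad a b c : ℝ) ^ (κ' + ε) by
    intro a b c h hc
    rcases le_total a b with hab | hba
    · exact hmain a b c h hab hc
    · obtain ⟨ha, hb, habc, hcop⟩ := h
      have h' : IsABCTriple b a c := ⟨hb, ha, by omega, hcop.symm⟩
      have hrad : rad b a c = rad a b c := by rw [rad_def, rad_def, mul_comm b a]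
      have := hmain b a c h' hba hc
      rwa [hrad] at this
  intro a b c h hab hc3r
  have hc3 : 3 ≤ c := by exact_mod_cast hc3r
  have hsq := log_sq_le_of_finBound hK hL hκ'1 hσ0 hσ hP' h hab hc3
  -- notation
  set r : ℕ := (a * b * c).primeFactors.card with hr
  set G : ℝ := (rad a b c : ℝ) with hGdef
  have hG1 : 1 ≤ G := one_le_rad_real a b c
  have hG0 : 0 < G := by linarith
  set u : ℝ := Real.log c with hudef
  have hu1 : 1 ≤ u := by
    rw [hudef, ← Real.log_exp 1]
    apply Real.log_le_log (Real.exp_pos 1)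
    have := Real.exp_one_lt_d9; linarith
  have hu0 : 0 < u := by linarith
  -- `D^r ≤ AD · G^{ε₁}`
  have hrr : ((r : ℝ)) ^ r ≤ 600 ^ (r + 1) * G := by rw [hr, hGdef]; exact card_pow_card_le_rad a b c
  have hDr := hAD r G hG1 hrr
  -- `(log G)^{N₁} ≤ c · G^{ε₁}`
  have hLG := log_pow_le_mul_rpow hε₁0 N₁ hG1
  -- `(log (6u))^{N₂} ≤ c · (6u)^δ`
  have h6u : (1 : ℝ) ≤ 6 * u := by linarith
  have hLc := log_pow_le_mul_rpow hδ0 N₂ h6u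
  -- the factor `((600^{r+1} G)²)^{κ'−1} = E^{r+1} · (G²)^{κ'−1}`
  have h600 : (0 : ℝ) ≤ 600 := by norm_num
  have hEpow : (((600 : ℝ) ^ (r + 1)) ^ 2) ^ (κ' - 1) = E ^ (r + 1) := by
    rw [hE, ← pow_mul, ← Real.rpow_natCast (600 : ℝ) ((r + 1) * 2), ← Real.rpow_mul h600,
      ← Real.rpow_natCast ((600 : ℝ) ^ (2 * (κ' - 1))) (r + 1), ← Real.rpow_mul h600]
    congr 1; push_cast; ring
  have hW2 : (((600 : ℝ) ^ (r + 1) * G) ^ 2) ^ (κ' - 1) = E ^ (r + 1) * (G ^ 2) ^ (κ' - 1) := by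
    rw [mul_pow, Real.mul_rpow (by positivity) (by positivity), hEpow]
  have hG2κ : G ^ 2 * (G ^ 2) ^ (κ' - 1) = G ^ (2 * κ') := by
    rw [show G ^ 2 = G ^ (2 : ℝ) by rw [show (2 : ℝ) = ((2 : ℕ) : ℝ) by norm_num, Real.rpow_natCast],
      ← Real.rpow_mul hG0.le, ← Real.rpow_add hG0]
    congr 1; ring
  -- assemble: `u² ≤ C₁ · G^{2κ'+2ε₁} · (log 6u)^{N₂}`
  have hstep : u ^ 2 ≤ C₁ * G ^ (2 * κ' + 2 * ε₁) * Real.log (6 * u) ^ N₂ := by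
    have hsq' := hsq
    rw [hW2] at hsq'
    have e1 : 512 * max 1 K ^ 2 * (600 * M₀) ^ (2 * r) * 600 ^ 2 * G ^ 2 *
        (E ^ (r + 1) * (G ^ 2) ^ (κ' - 1)) * Real.log G ^ N₁ * Real.log (6 * u) ^ N₂ =
        (512 * max 1 K ^ 2 * 600 ^ 2 * E) * (D ^ r * (G ^ 2 * (G ^ 2) ^ (κ' - 1))) * Real.log G ^ N₁ *
          Real.log (6 * u) ^ N₂ := by
      rw [hD, mul_pow ((600 * M₀) ^ 2) E r, ← pow_mul, pow_succ]; ring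
    rw [e1, hG2κ] at hsq'
    refine hsq'.trans ?_
    have hlog0 : 0 ≤ Real.log (6 * u) ^ N₂ := pow_nonneg (Real.log_nonneg h6u) _
    have e2 : C₁ * G ^ (2 * κ' + 2 * ε₁) * Real.log (6 * u) ^ N₂ =
        (512 * max 1 K ^ 2 * 600 ^ 2 * E) * ((AD * G ^ ε₁) * G ^ (2 * κ')) *
          ((((N₁ : ℝ) + 1) / ε₁) ^ N₁ * G ^ ε₁) * Real.log (6 * u) ^ N₂ := by
      rw [hC₁, show 2 * κ' + 2 * ε₁ = ε₁ + 2 * κ' + ε₁ by ring, Real.rpow_add hG0, Real.rpow_add hG0]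
      ring
    rw [e2]
    have h0 : 0 ≤ 512 * max 1 K ^ 2 * 600 ^ 2 * E := by positivity
    refine mul_le_mul_of_nonneg_right ?_ hlog0
    refine mul_le_mul ?_ hLG (pow_nonneg (Real.log_nonneg hG1) _) (by positivity)
    exact mul_le_mul_of_nonneg_left (mul_le_mul_of_nonneg_right hDr (by positivity)) h0
  -- `u² ≤ C₂ · G^{θ} · u^δ`
  have hstep2 : u ^ 2 ≤ C₂ * G ^ (2 * κ' + 2 * ε₁) * u ^ δ := by
    refine hstep.trans ?_
    have h6 : (6 * u) ^ δ = (6 : ℝ) ^ δ * u ^ δ := Real.mul_rpow (by norm_num) hu0.le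
    calc C₁ * G ^ (2 * κ' + 2 * ε₁) * Real.log (6 * u) ^ N₂
        ≤ C₁ * G ^ (2 * κ' + 2 * ε₁) * ((((N₂ : ℝ) + 1) / δ) ^ N₂ * (6 * u) ^ δ) :=
          mul_le_mul_of_nonneg_left hLc (by positivity)
      _ = C₂ * G ^ (2 * κ' + 2 * ε₁) * u ^ δ := by rw [h6, hC₂]; ring
  -- resolve
  have hres := le_rpow_of_sq_le hu1 (by linarith) hstep2
  refine hres.trans ?_
  rw [Real.mul_rpow hC₂0.le (Real.rpow_nonneg hG0.le _), ← Real.rpow_mul hG0.le]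
  refine mul_le_mul_of_nonneg_left ?_ (Real.rpow_nonneg hC₂0.le _)
  refine Real.rpow_le_rpow_of_exponent_le hG1 ?_
  -- `(2κ' + ε/2)/(2 − δ) ≤ κ' + ε` with `δ = ε/(κ'+ε)`
  have hd : 0 < 2 - δ := by linarith
  rw [mul_one_div, div_le_iff₀ hd, hε₁, hδ]
  have hk : 0 < κ' + ε := by positivity
  have e : (κ' + ε) * (2 - ε / (κ' + ε)) = 2 * κ' + ε := by field_simp; ring
  rw [e]; linarith

end KappaDoor

end Summit.ABC.StewartYu

end
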